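import Summits.RiemannHypothesis.RiemannHypothesis.Theorems.PfPersistenceM2EvenSectorSummableMultiplier
import Summits.RiemannHypothesis.RiemannHypothesis.Theorems.PfPersistenceM2EvenSectorZeroBudget
import Literature.NumberTheory.LFunctions.ZeroDensityIngham
import Literature.NumberTheory.LFunctions.ZetaArgVariation
import HarnessLib

/-!
# Even sector of the Pf-persistence index route (M2): the ladder, unconditionally

Long-odds MECHANISM SEARCH (cell `pub-rhpf`, seat M2); every result here is RH-free and makes
no claim about RH.

One-line compositions (recorded at the request of the cell's adjudication, ruling A191 (2)): the
Literature tree PROVES Ingham's zero-density theorem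
(`Literature.NumberTheory.LFunctions.zeroDensity_ingham_holds`, `ZeroDensityIngham.lean`, from the
fourth moment of `ζ`) and the Riemann–von Mangoldt formula
(`Literature.NumberTheory.LFunctions.riemann_von_mangoldt_holds`, `ZetaArgVariation.lean`), so the
hypotheses `(h : zeroDensity_ingham)` of `PfPersistenceM2EvenSectorSummableMultiplier` /
`…ZeroDensity` and `(h₁ : riemann_von_mangoldt)` of `…LevelZero` / `…ZeroBudget` are discharged:

* UNCONDITIONAL (RH-free theorems): `summable_inv_im_quadrant` ((SUM_θ)),
  `quadrantCountingPowerBound_pos`, `quadrantMultiplier_pos` ((MULT_θ)), `quadrantAnnihilable_pos`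
  ((QA_θ)) for every `θ > 0`; the EVEN LADDER `forall_not_evenNegIndexAtLeast_succ_iff_encard`
  (`L_n^ev ⟺ K ≤ n` for every `n`, `K = #{ρ : Re ρ > 1/2, Im ρ > 0} ∈ ℕ ∪ {∞}`) and
  `exists_evenNegIndexAtLeast_iff_encard` ((∃ window with even negative index `≥ n`) ⟺ `n ≤ K`):
  the eventual negative index of Weil's form on the even real sector EQUALS the number of zero
  quadruples off the critical line, with no hypothesis at all.
* Conditional on ONE cited named fact, `Anderson1983_levinson_simple` (Levinson–Heath-Brown–
  Anderson, Titchmarsh §10.29 (10.29.1)): `not_quadrantMultiplier_zero_of_anderson`,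
  `quadrantMultiplier_iff_pos` ((MULT_θ) ⟺ θ > 0 — the multiplier ladder decided at every level),
  `weilMellin_eq_zero_of_vanish_simpleCritical_of_anderson`,
  `tendsto_vanishing_simpleCritical_ratio_of_anderson`.

Level `0` of the index ladder (`L_0^ev`) is equivalent to RH (earlier files) and is not touched.
-/

open Complex Filter Set MeasureTheory
open scoped Real Topology

namespace Summit.RiemannHypothesis.RiemannHypothesis.Theorems.PfPersistenceM2NegIndex

open Literature.NumberTheory.LFunctions
open Literature.NumberTheory.LFunctions.ZetaZeros

/-! ## `θ > 0`: unconditional -/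

/-- **(SUM_θ), unconditional:** for every `θ > 0`, `∑_{ρ ∈ 𝒵_θ} 1/Im ρ < ∞` (Ingham's zero-density
theorem is a theorem of the tree). [cite: Titchmarsh1986, Thm. 9.19(B)] -/
theorem summable_inv_im_quadrant {θ : ℝ} (hθ : 0 < θ) :
    Summable fun ρ : ↥{ρ : ℂ | ρ ∈ riemannZetaNontrivialZeros ∧ 1 / 2 + θ ≤ ρ.re ∧ 0 < ρ.im} ↦
      1 / (ρ : ℂ).im :=
  summable_inv_im_quadrant_of_ingham zeroDensity_ingham_holds hθ

/-- The power-saving counting shape of `𝒵_θ`, unconditional for every `θ > 0`.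
[cite: Titchmarsh1986, Thm. 9.19(B)] -/
theorem quadrantCountingPowerBound_pos {θ : ℝ} (hθ : 0 < θ) : QuadrantCountingPowerBound θ :=
  quadrantCountingPowerBound_of_ingham zeroDensity_ingham_holds hθ

/-- **(MULT_θ), unconditional:** for every `θ > 0` one even real Weil test function with `φ̂ ≢ 0`
annihilates the whole quadrant `𝒵_θ`. [cite: Titchmarsh1986, Thm. 9.19(B)] -/
theorem quadrantMultiplier_pos {θ : ℝ} (hθ : 0 < θ) : QuadrantMultiplier θ :=
  quadrantMultiplier_of_ingham zeroDensity_ingham_holds hθ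

/-- **(QA_θ), unconditional** for every `θ > 0`. [cite: Titchmarsh1986, Thm. 9.19(B)] -/
theorem quadrantAnnihilable_pos {θ : ℝ} (hθ : 0 < θ) : QuadrantAnnihilable θ :=
  quadrantAnnihilable_of_ingham zeroDensity_ingham_holds hθ

/-- **THE EVEN LADDER, UNCONDITIONAL: `L_n^ev ⟺ K ≤ n` for every `n ≥ 0`** — Weil's form on the
even real sector has negative index `≤ n` on every window iff at most `n` nontrivial zeros lie in
the open quadrant `Re ρ > 1/2, Im ρ > 0` (`K = ∞` allowed, in `ℕ∞`). RH-free theorem; no named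
fact remains. [cite: Bombieri2000Weil, Thm 9 (even part)] -/
theorem forall_not_evenNegIndexAtLeast_succ_iff_encard (n : ℕ) :
    (∀ a : ℝ, ¬ EvenNegIndexAtLeast (n + 1) a) ↔
      {ρ : ℂ | ρ ∈ riemannZetaNontrivialZeros ∧ 1 / 2 < ρ.re ∧ 0 < ρ.im}.encard ≤ n :=
  forall_not_evenNegIndexAtLeast_succ_iff_of_ingham zeroDensity_ingham_holds n

/-- **Eventual even negative index `= K` for every `K ∈ ℕ ∪ {∞}`, unconditional:** some window
carries even negative index `≥ n` iff `n ≤ K`. [cite: Bombieri2000Weil, Thm 9 (even part)] -/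
theorem exists_evenNegIndexAtLeast_iff_encard (n : ℕ) :
    (∃ a : ℝ, EvenNegIndexAtLeast n a) ↔
      (n : ℕ∞) ≤ {ρ : ℂ | ρ ∈ riemannZetaNontrivialZeros ∧ 1 / 2 < ρ.re ∧ 0 < ρ.im}.encard :=
  exists_evenNegIndexAtLeast_iff_of_ingham zeroDensity_ingham_holds n

/-- `L_n^ev ⇒ K ≤ n`, unconditional (the hypothesis-free trichotomies
`encard_le_or_exists_not_summable` / `…_not_counting` / `encard_le_or_not_ingham` with their
escape branches now closed). [cite: Bombieri2000Weil, Thm 9 (even part)] -/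
theorem encard_le_of_forall_not_evenNegIndexAtLeast (n : ℕ)
    (hno : ∀ a : ℝ, ¬ EvenNegIndexAtLeast (n + 1) a) :
    {ρ : ℂ | ρ ∈ riemannZetaNontrivialZeros ∧ 1 / 2 < ρ.re ∧ 0 < ρ.im}.encard ≤ n :=
  (forall_not_evenNegIndexAtLeast_succ_iff_encard n).1 hno

/-! ## `θ ≤ 0`: conditional on `Anderson1983_levinson_simple` only -/

/-- A Weil test function whose Mellin transform vanishes at every simple critical zero has
`φ̂ ≡ 0` — conditional on the single named fact `Anderson1983_levinson_simple` (the
Riemann–von Mangoldt formula is a theorem of the tree). [cite: Titchmarsh1986, §10.29] -/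
theorem weilMellin_eq_zero_of_vanish_simpleCritical_of_anderson
    (h₂ : Anderson1983_levinson_simple) {φ : ℝ → ℂ} (hφ : IsWeilTest φ)
    (hvan : ∀ ρ : ℂ, riemannZeta ρ = 0 → ρ.re = 1 / 2 → 0 < ρ.im → riemannZetaZeroOrder ρ = 1 →
      weilMellin φ ρ = 0) :
    weilMellin φ = 0 :=
  weilMellin_eq_zero_of_vanish_simpleCritical riemann_von_mangoldt_holds h₂ hφ hvan

/-- **Level-zero no-go, one named fact:** `¬ QuadrantMultiplier 0` conditional on
`Anderson1983_levinson_simple`. [cite: Titchmarsh1986, §10.29] -/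
theorem not_quadrantMultiplier_zero_of_anderson (h₂ : Anderson1983_levinson_simple) :
    ¬ QuadrantMultiplier 0 :=
  not_quadrantMultiplier_zero riemann_von_mangoldt_holds h₂

/-- **The multiplier ladder decided at every level:** conditional on
`Anderson1983_levinson_simple`, `QuadrantMultiplier θ ⟺ 0 < θ` (the direction `0 < θ ⇒ (MULT_θ)`
is unconditional, `quadrantMultiplier_pos`). [cite: Titchmarsh1986, §10.29] -/
theorem quadrantMultiplier_iff_pos (h₂ : Anderson1983_levinson_simple) {θ : ℝ} :
    QuadrantMultiplier θ ↔ 0 < θ := by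
  refine ⟨fun h ↦ ?_, quadrantMultiplier_pos⟩
  by_contra hθ
  exact not_quadrantMultiplier_of_nonpos riemann_von_mangoldt_holds h₂ (not_lt.1 hθ) h

/-- Conditional on `Anderson1983_levinson_simple`: a Weil test function with `φ̂ ≢ 0` vanishes at
an asymptotically NULL proportion of the simple critical zeros up to height `T`.
[cite: Titchmarsh1986, §10.29] -/
theorem tendsto_vanishing_simpleCritical_ratio_of_anderson (h₂ : Anderson1983_levinson_simple)
    {φ : ℝ → ℂ} (hφ : IsWeilTest φ) (hne : weilMellin φ ≠ 0) :
    Tendsto (fun T : ℝ ↦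
      (({ρ ∈ zetaZeroBox (1 / 2) T | ρ.re = 1 / 2 ∧ riemannZetaZeroOrder ρ = 1 ∧
        weilMellin φ ρ = 0}.ncard : ℕ) : ℝ) / simpleCriticalZeroCount T) atTop (𝓝 0) :=
  tendsto_vanishing_simpleCritical_ratio riemann_von_mangoldt_holds h₂ hφ hne

end Summit.RiemannHypothesis.RiemannHypothesis.Theorems.PfPersistenceM2NegIndex
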